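import Literature.AnabelianGeometry.EtaleTheta.FrobenioidThetaDivisors
import Mathlib.Data.Finsupp.Basic
import Mathlib.Data.Set.Card

/-!
# [EtTh] §5, Proposition 5.3 (iv)–(vi): the divisor-support vocabulary of the printed proof (pp. 326–327 / PDF pp. 100–101)

Mochizuki, *The étale theta function …*, Publ. RIMS **45** (2009)
[cite: MochizukiEtTh2009, Prop 5.3 proof p.326–327 (PDF pp.100–101)].  Seat abc-iut-L2-d4 (merge row W3-L2-03 of
plan/L2/ASSIGNMENTS.md §J, ruled by abc-iut-L2-lead 2026-08-26T01:20Z); ADDITIVE vocabulary over abc-iut-L2-t4's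
FROZEN `FrobenioidThetaDivisors.lean` (`DivisorPrimeData 𝔓`: cuspidal/non-cuspidal primes, the surjection
`cspToNcsp`, the labels `ncspEquivZ`, `div(Θ̈)`, the action `pullAut`) — no declaration of that file is touched.

WHY.  Prop. 5.3 (iv) (the surjection `Prime(Φ(A_⊚))^csp ↠ Prime(Φ(A_⊚))^ncsp`), (v) (the labels `Prime^ncsp ⥲ ℤ`
up to `±1`/translation — reduced to ADJACENCY by this seat's `Sec5Prop53.preservesNcspLabels_of_adjacency`) and
(vi) (the `Aut_C(A_⊚)`-orbit of `div(Θ̈)`) are proved in print through "the well-known intersection theory of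
divisors supported on the chain of copies of the projective line" (p.326 (PDF p.100)) in a vocabulary that
`DivisorPrimeData` does not carry.  This file types exactly the PRINTED part of it:
* DATA (`DivisorSupportData`): F2 `factor` — the (injective) factorization homomorphism of [FrdI] Def. 2.4
  (i)(c) `Φ(A_⊚) ↪ Φ(A_⊚)^pf ⊆ ∏_𝔭 Φ(A_⊚)^pf_𝔭`, each line `Φ(A_⊚)^pf_𝔭 ≅ ℚ_{≥0}·gen_𝔭` being coordinatised by
  the prime log-divisor `gen 𝔭` generating `Φ(A_⊚)_𝔭 ≅ ℤ_{≥0}` (`C` "of monoid type `ℤ`", [EtTh] Def. 3.6 (i)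
  p.302 (PDF p.76)) — coordinates of PRIMARY elements are positive integers, those of general elements rational
  (the components of the special fibre are in general only `ℚ`-Cartier: Prop. 3.2 (i) proof, p.297 (PDF p.71),
  "`e·D`, `e·E` are Cartier"); F1 `principal` —
  "the image of the birational function monoid of the Frobenioid `C`" (p.326); F3 `incidence`, F5
  `ordGp_divTheta_cusp`, F6 `exists_translate` — the three printed geometric sentences used for (iv), (vi);
* DEFINITIONS, verbatim from p.326 (PDF p.100): "linearly equivalent", "principal", "support" ([FrdI] Def. 2.4
  (i)(d)), "coprime", "cuspidally minimal" (`LinEquivOf`, `suppOf`, `CoprimeOf`, `IsCuspidallyMinimalOf`);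
* the two VERBATIM CRITERIA of the proof as `Prop`-valued predicates ON THE DATA (F4-verbatim): the description
  of the surjection of (iv) (`CspToNcspCriterion`, `CspToNcspWitnessed`, p.326) and the "4 versus 5 or 6" adjacency
  criterion of (v) (`AdjacencyCriterion`, pp.326–327).
Per the ruling, the STRUCTURAL intersection-theoretic description behind "well-known" (intersection numbers with
every component vanish for principal divisors) — NOT verbatim in print — is neither a field nor a definition here;
it may only enter later theorems as an explicit hypothesis binder (GAP-LEDGER row G-L2d4-2: wanted for the genuine
special fibre of `Ÿ`; owner ∅), from which the two criteria are to be PROVED.  Nothing here lies inside the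
[IUTchIII] Cor. 3.12 cone (Prop. 5.3 feeds Thm. 5.6/5.7 only through (vi) ↦ the divisor matching `hdiv` of
`Discharge/Sec5Thm57*.lean`).
HONEST FRAMING: data, definitions and predicates; no field asserts a result about an actual curve (instances are
to be CONSTRUCTED from the model, abc-iut-L2-t9 / the special-fibre owner); typed ≠ proved; no side taken on
anything downstream. -/

namespace Literature.AnabelianGeometry.EtaleTheta

open CategoryTheory
open Literature.AlgebraicGeometry.Frobenioids

universe w v v' u u'

namespace FrobenioidThetaDivisors

section Defs

variable {Φ : Type w} [CommMonoid Φ]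

/-- The order at `𝔭`: the `𝔭`-component `Φ(A_⊚) → Φ(A_⊚)^pf_𝔭 ≅ ℚ_{≥0} ⊆ ℚ` of a factorization homomorphism
([FrdI] Def. 2.4 (i)(c); for monoid type `ℤ` the line `Φ(A_⊚)^pf_𝔭` is `ℚ_{≥0} · gen_𝔭`).
[cite: MochizukiEtTh2009, Prop 5.3 proof p.326 (PDF p.100)] -/
noncomputable def ordOf (factor : Φ →* Multiplicative (Primes Φ →₀ ℚ)) (𝔭 : Primes Φ) :
    Φ →* Multiplicative ℚ :=
  (AddMonoidHom.toMultiplicative (Finsupp.applyAddHom 𝔭)).comp factor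

/-- The order at `𝔭` on `Φ(A_⊚)^gp` (universal property of the Grothendieck group): supports of elements of
`Φ(A_⊚)^gp` are read off these (p.326 (PDF p.100) "support [cf. [FrdI], Definition 2.4, (i), (d)]" of an
element `∈ Φ(A_⊚)^gp`).  [cite: MochizukiEtTh2009, Prop 5.3 proof p.326 (PDF p.100)] -/
noncomputable def ordGpOf (factor : Φ →* Multiplicative (Primes Φ →₀ ℚ)) (𝔭 : Primes Φ) :
    Algebra.GrothendieckGroup Φ →* Multiplicative ℚ :=
  Algebra.GrothendieckGroup.lift (ordOf factor 𝔭)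

/-- "support [cf. [FrdI], Definition 2.4, (i), (d)]" of an element of `Φ(A_⊚)^gp`: the primes at which its order
is non-zero (p.326 (PDF p.100)).  [cite: MochizukiEtTh2009, Prop 5.3 proof p.326 (PDF p.100)] -/
def suppOf (factor : Φ →* Multiplicative (Primes Φ →₀ ℚ)) (x : Algebra.GrothendieckGroup Φ) :
    Set (Primes Φ) :=
  {𝔭 | ordGpOf factor 𝔭 x ≠ 1}

/-- "Let us refer to pairs of elements of `Φ(A_⊚)^gp` whose difference lies in the image of the birational
function monoid of the Frobenioid `C` as linearly equivalent" (p.326 (PDF p.100)), for that image `P`.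
[cite: MochizukiEtTh2009, Prop 5.3 proof p.326 (PDF p.100)] -/
def LinEquivOf (P : Subgroup (Algebra.GrothendieckGroup Φ)) (x y : Algebra.GrothendieckGroup Φ) : Prop :=
  x * y⁻¹ ∈ P

/-- "Let us refer to an element `∈ Φ(A_⊚)^gp` which is linearly equivalent to `0` as principal" (p.326
(PDF p.100)).  [cite: MochizukiEtTh2009, Prop 5.3 proof p.326 (PDF p.100)] -/
def IsPrincipalOf (P : Subgroup (Algebra.GrothendieckGroup Φ)) (x : Algebra.GrothendieckGroup Φ) : Prop :=
  LinEquivOf P x 1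

/-- "`b` … coprime to `a` [i.e., `a`, `b` have disjoint supports]" (p.326 (PDF p.100)).
[cite: MochizukiEtTh2009, Prop 5.3 proof p.326 (PDF p.100)] -/
def CoprimeOf (factor : Φ →* Multiplicative (Primes Φ →₀ ℚ)) (x y : Algebra.GrothendieckGroup Φ) : Prop :=
  Disjoint (suppOf factor x) (suppOf factor y)

variable {C : Type u} [Category.{v} C] {D : Type u'} [Category.{v'} D] {𝔉 : ThetaFrobenioid.{w} C D}

/-- A cuspidal element of `Φ(A_⊚)^gp`: one whose support consists of cuspidal primes (p.326 (PDF p.100)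
"cuspidal element of `Φ(A_⊚)^gp`"; Def. 3.1 (i) p.296 (PDF p.70): a log-divisor "whose support lies in … the
divisor of cusps"), read through abc-iut-L2-t4's `DivisorPrimeData.IsCuspidal` on primes.
[cite: MochizukiEtTh2009, Prop 5.3 proof p.326 (PDF p.100); Def 3.1 (i) p.296 (PDF p.70)] -/
def IsCuspidalGpOf (𝔓 : DivisorPrimeData 𝔉) (factor : 𝔉.PhiAcirc →* Multiplicative (Primes 𝔉.PhiAcirc →₀ ℚ))
    (x : Algebra.GrothendieckGroup 𝔉.PhiAcirc) : Prop :=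
  ∀ 𝔭 ∈ suppOf factor x, 𝔓.IsCuspidal 𝔭

/-- "Let us refer to as cuspidally minimal any cuspidal element of `Φ(A_⊚)^gp` whose support … is a finite set of
minimal cardinality among the cardinalities of supports of cuspidal elements of `Φ(A_⊚)^gp` which are linearly
equivalent to the given element" (p.326 (PDF p.100)).  [cite: MochizukiEtTh2009, Prop 5.3 proof p.326 (PDF p.100)] -/
def IsCuspidallyMinimalOf (𝔓 : DivisorPrimeData 𝔉)
    (factor : 𝔉.PhiAcirc →* Multiplicative (Primes 𝔉.PhiAcirc →₀ ℚ))
    (P : Subgroup (Algebra.GrothendieckGroup 𝔉.PhiAcirc)) (x : Algebra.GrothendieckGroup 𝔉.PhiAcirc) : Prop :=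
  IsCuspidalGpOf 𝔓 factor x ∧ (suppOf factor x).Finite ∧
    ∀ y, IsCuspidalGpOf 𝔓 factor y → LinEquivOf P y x → (suppOf factor x).ncard ≤ (suppOf factor y).ncard

/-- Adjacency "[in the 'chain of copies of the projective line']" of two non-cuspidal primes, read on
abc-iut-L2-t4's labels `Prime^ncsp ⥲ ℤ` (p.326 (PDF p.100); invariant under the `±1`/translation ambiguity).
[cite: MochizukiEtTh2009, Prop 5.3 proof p.326 (PDF p.100)] -/
def Adjacent (𝔓 : DivisorPrimeData 𝔉) (𝔭 𝔮 : {p : Primes 𝔉.PhiAcirc // ¬ 𝔓.IsCuspidal p}) : Prop :=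
  |𝔓.ncspEquivZ 𝔭 - 𝔓.ncspEquivZ 𝔮| = 1

end Defs

variable {C : Type u} [Category.{v} C] {D : Type u'} [Category.{v'} D] {𝔉 : ThetaFrobenioid.{w} C D}

/-- **The divisor-support vocabulary of the proof of Proposition 5.3** (pp.326–327 (PDF pp.100–101)), over
abc-iut-L2-t4's `DivisorPrimeData 𝔓`.  Fields = PRINTED items only (F1, F2, F3, F5, F6 of the W3-L2-03 ruling):
* `factor` (F2): the factorization homomorphism of `Φ(A_⊚)` by its primes ([FrdI] Def. 2.4 (i)(c): injective,
  `Φ ↪ Φ^pf ⊆ ∏_𝔭 Φ^pf_𝔭`), the line `Φ(A_⊚)^pf_𝔭 ≅ ℚ_{≥0}` being coordinatised by the prime log-divisor `gen 𝔭`,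
  the generator of `Φ(A_⊚)_𝔭 ≅ ℤ_{≥0}` (`C` "of monoid type `ℤ`", [EtTh] Def. 3.6 (i) p.302 (PDF p.76); p.322
  (PDF p.96)); `factor_carrier`: the primary elements of `𝔭` are exactly the positive INTEGER multiples of
  `gen 𝔭` (coordinates of non-primary elements may be rational: the components of the special fibre are only
  `ℚ`-Cartier in general, Prop. 3.2 (i) proof p.297 (PDF p.71));
* `principal` (F1): "the image of the birational function monoid of the Frobenioid `C`" in `Φ(A_⊚)^gp` (p.326);
* `incidence` (F3): the p.326 sentence "in this situation, `n` is linearly equivalent to some element … of the form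
  `n₁ + n₂ − a` …" with its multiplicity clause;
* `ordGp_divTheta_cusp` (F5): Prop. 1.4 (i) (p.247 (PDF p.21): "the zeroes of `Θ̈` on `Ÿ` are precisely the cusps
  of `Ÿ`; each zero has multiplicity 1") read on `div(Θ̈) ∈ Φ(A_⊚)^gp` of Prop. 5.3 (vi);
* `exists_translate` (F6): the `Aut_C(A_⊚)`-action of (vi) (p.326 (PDF p.100)) realises every translation of the
  chain of components (`Z = Gal(Y/X) (≅ ℤ)`, §1 p.238 (PDF p.12), permutes the "infinite chain of copies of the
  projective line" whose components are labelled by `ℤ` after the choice of a basepoint, p.239 (PDF p.13);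
  "`ℤ (≅ Gal(Ÿ/Ẋ))`" in the wording of Thm. 5.7).
[cite: MochizukiEtTh2009, Prop 5.3 proof p.326–327 (PDF pp.100–101); Def 3.6 (i) p.302 (PDF p.76); Prop 1.4 (i) p.247 (PDF p.21); §1 p.238–239 (PDF pp.12–13)] -/
structure DivisorSupportData (𝔓 : DivisorPrimeData 𝔉) where
  /-- F2: the factorization homomorphism `Φ(A_⊚) → ∏_𝔭 Φ(A_⊚)^pf_𝔭`, `Φ(A_⊚)^pf_𝔭 ≅ ℚ_{≥0}·gen_𝔭` ([FrdI] Def. 2.4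
  (i)(c); monoid type `ℤ`, [EtTh] Def. 3.6 (i)), finitely supported. -/
  factor : 𝔉.PhiAcirc →* Multiplicative (Primes 𝔉.PhiAcirc →₀ ℚ)
  /-- the factorization homomorphism is injective ([FrdI] Def. 2.4 (i)(c): `Φ` perf-factorial). -/
  factor_injective : Function.Injective factor
  /-- its coordinates are non-negative (`Φ(A_⊚)^pf_𝔭 ≅ ℚ_{≥0}`). -/
  factor_nonneg : ∀ (a : 𝔉.PhiAcirc) (𝔭 : Primes 𝔉.PhiAcirc), 0 ≤ Multiplicative.toAdd (factor a) 𝔭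
  /-- the prime log-divisor of `𝔭` (p.325 (PDF p.99): "the elements … that arise from [scheme-theoretic] prime
  log-divisors"), the generator of `Φ(A_⊚)_𝔭 ≅ ℤ_{≥0}`. -/
  gen : Primes 𝔉.PhiAcirc → 𝔉.PhiAcirc
  /-- `gen 𝔭` has order `1` at `𝔭` and `0` elsewhere. -/
  factor_gen : ∀ 𝔭 : Primes 𝔉.PhiAcirc, factor (gen 𝔭) = Multiplicative.ofAdd (Finsupp.single 𝔭 1)
  /-- the primary elements of `𝔭` are exactly the positive multiples of its prime log-divisor (`Φ(A_⊚)_𝔭 ≅ ℤ_{≥0}`,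
  [FrdI] Def. 2.4 (i); Rmk. 3.8.2 / p.325 (PDF p.99)). -/
  factor_carrier : ∀ (𝔭 : Primes 𝔉.PhiAcirc) (a : 𝔉.PhiAcirc),
    a ∈ 𝔭.carrier ↔ ∃ n : ℕ, 0 < n ∧ factor a = Multiplicative.ofAdd (Finsupp.single 𝔭 (n : ℚ))
  /-- F1: "the image of the birational function monoid of the Frobenioid `C`" in `Φ(A_⊚)^gp` (p.326 (PDF p.100)). -/
  principal : Subgroup (Algebra.GrothendieckGroup 𝔉.PhiAcirc)
  /-- F3 (p.326 (PDF p.100)).  For "primary cuspidal elements `a ∈ Φ(A_⊚)` such that, for some `b ∈ Φ(A_⊚)^csp`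
  which is coprime to `a` …, `b − a` is cuspidally minimal and linearly equivalent to a primary non-cuspidal
  element `n ∈ Φ(A_⊚)`": "in this situation, `n` is linearly equivalent to some element ∈ `Φ(A_⊚)^gp` of the form
  `n₁ + n₂ − a`, where `n₁, n₂ ∈ Φ(A_⊚)^csp` are primary cuspidal elements that map, respectively, via the natural
  surjection of (iv) to the two non-cuspidal primes that are adjacent … to the non-cuspidal prime determined by
  `n`. Moreover, relative to the isomorphisms of (iii), the multiplicities of `n₁, n₂` are equal to each other as
  well as to half the multiplicity of `a`."  (Multiplicative notation in `Φ(A_⊚)^gp`; multiplicities = orders.) -/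
  incidence : ∀ (𝔞 𝔫 : Primes 𝔉.PhiAcirc) (h𝔫 : ¬ 𝔓.IsCuspidal 𝔫) (a b n : 𝔉.PhiAcirc),
    𝔓.IsCuspidal 𝔞 → a ∈ 𝔞.carrier → n ∈ 𝔫.carrier →
    IsCuspidalGpOf 𝔓 factor (Algebra.GrothendieckGroup.of b) →
    CoprimeOf factor (Algebra.GrothendieckGroup.of a) (Algebra.GrothendieckGroup.of b) →
    IsCuspidallyMinimalOf 𝔓 factor principal
      (Algebra.GrothendieckGroup.of b * (Algebra.GrothendieckGroup.of a)⁻¹) →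
    LinEquivOf principal (Algebra.GrothendieckGroup.of b * (Algebra.GrothendieckGroup.of a)⁻¹)
      (Algebra.GrothendieckGroup.of n) →
    ∃ (𝔠₁ 𝔠₂ : Primes 𝔉.PhiAcirc) (h₁ : 𝔓.IsCuspidal 𝔠₁) (h₂ : 𝔓.IsCuspidal 𝔠₂) (m : ℕ),
      𝔓.ncspEquivZ (𝔓.cspToNcsp ⟨𝔠₁, h₁⟩) = 𝔓.ncspEquivZ ⟨𝔫, h𝔫⟩ - 1 ∧
      𝔓.ncspEquivZ (𝔓.cspToNcsp ⟨𝔠₂, h₂⟩) = 𝔓.ncspEquivZ ⟨𝔫, h𝔫⟩ + 1 ∧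
      ordOf factor 𝔞 a = Multiplicative.ofAdd (2 * (m : ℚ)) ∧
      LinEquivOf principal (Algebra.GrothendieckGroup.of n)
        (Algebra.GrothendieckGroup.of (gen 𝔠₁ ^ m * gen 𝔠₂ ^ m) *
          (Algebra.GrothendieckGroup.of a)⁻¹)
  /-- F5 (Prop. 1.4 (i), p.247 (PDF p.21), read on `div(Θ̈)` of Prop. 5.3 (vi)): `div(Θ̈)` has order exactly `1` at
  every cuspidal prime ("the zeroes of `Θ̈` … are precisely the cusps …; each zero has multiplicity 1"). -/
  ordGp_divTheta_cusp : ∀ 𝔠 : Primes 𝔉.PhiAcirc, 𝔓.IsCuspidal 𝔠 →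
    ordGpOf factor 𝔠 𝔓.divTheta = Multiplicative.ofAdd 1
  /-- F6: every translation `t ∈ ℤ` of the chain of components is realised by some `g ∈ Aut_C(A_⊚)` acting on
  `Φ(A_⊚)` by pull-back (`pullAut`), cuspidal primes going to cuspidal primes (`Z = Gal(Y/X) ≅ ℤ` translates the
  "infinite chain of copies of the projective line", §1 p.238–239 (PDF pp.12–13); "the `Aut_C(A_⊚)`-orbit",
  Prop. 5.3 (vi) p.326 (PDF p.100)). -/
  exists_translate : ∀ t : ℤ, ∃ g : Aut 𝔉.Acirc,
    (∀ 𝔭, 𝔓.IsCuspidal (Primes.congr (𝔉.pullAut g) 𝔭) ↔ 𝔓.IsCuspidal 𝔭) ∧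
    ∀ (𝔭 : Primes 𝔉.PhiAcirc) (h𝔭 : ¬ 𝔓.IsCuspidal 𝔭) (h𝔭' : ¬ 𝔓.IsCuspidal (Primes.congr (𝔉.pullAut g) 𝔭)),
      𝔓.ncspEquivZ ⟨Primes.congr (𝔉.pullAut g) 𝔭, h𝔭'⟩ = 𝔓.ncspEquivZ ⟨𝔭, h𝔭⟩ + t

namespace DivisorSupportData

variable {𝔓 : DivisorPrimeData 𝔉} (𝔖 : DivisorSupportData 𝔓)

/-- the order at `𝔭` on `Φ(A_⊚)^gp`. [cite: MochizukiEtTh2009, Prop 5.3 proof p.326 (PDF p.100)] -/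
noncomputable def ordGp (𝔭 : Primes 𝔉.PhiAcirc) : Algebra.GrothendieckGroup 𝔉.PhiAcirc →* Multiplicative ℚ :=
  ordGpOf 𝔖.factor 𝔭

/-- the support of an element of `Φ(A_⊚)^gp`. [cite: MochizukiEtTh2009, Prop 5.3 proof p.326 (PDF p.100)] -/
def supp (x : Algebra.GrothendieckGroup 𝔉.PhiAcirc) : Set (Primes 𝔉.PhiAcirc) := suppOf 𝔖.factor x

/-- linear equivalence in `Φ(A_⊚)^gp`. [cite: MochizukiEtTh2009, Prop 5.3 proof p.326 (PDF p.100)] -/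
def LinEquiv (x y : Algebra.GrothendieckGroup 𝔉.PhiAcirc) : Prop := LinEquivOf 𝔖.principal x y

/-- principal elements of `Φ(A_⊚)^gp`. [cite: MochizukiEtTh2009, Prop 5.3 proof p.326 (PDF p.100)] -/
def IsPrincipal (x : Algebra.GrothendieckGroup 𝔉.PhiAcirc) : Prop := IsPrincipalOf 𝔖.principal x

/-- cuspidally minimal elements of `Φ(A_⊚)^gp`. [cite: MochizukiEtTh2009, Prop 5.3 proof p.326 (PDF p.100)] -/
def IsCuspidallyMinimal (x : Algebra.GrothendieckGroup 𝔉.PhiAcirc) : Prop :=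
  IsCuspidallyMinimalOf 𝔓 𝔖.factor 𝔖.principal x

/-- `gen 𝔭` is a primary element of `𝔭`. [cite: MochizukiEtTh2009, Prop 5.3 p.325 (PDF p.99)] -/
theorem gen_mem_carrier (𝔭 : Primes 𝔉.PhiAcirc) : 𝔖.gen 𝔭 ∈ 𝔭.carrier :=
  (𝔖.factor_carrier 𝔭 _).mpr ⟨1, one_pos, 𝔖.factor_gen 𝔭⟩

/-- The order on `Φ(A_⊚)^gp` extends the order on `Φ(A_⊚)`. [cite: MochizukiEtTh2009, Prop 5.3 proof p.326 (PDF p.100)] -/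
theorem ordGp_of (𝔭 : Primes 𝔉.PhiAcirc) (a : 𝔉.PhiAcirc) :
    𝔖.ordGp 𝔭 (Algebra.GrothendieckGroup.of a) = ordOf 𝔖.factor 𝔭 a := by
  have h := Algebra.GrothendieckGroup.lift.symm_apply_apply (ordOf 𝔖.factor 𝔭)
  rw [Algebra.GrothendieckGroup.lift_symm_apply] at h
  exact DFunLike.congr_fun h a

/-- The order of the prime log-divisor `gen 𝔭` at `𝔭` is `1`. [cite: MochizukiEtTh2009, Prop 5.3 p.325 (PDF p.99)] -/
theorem ordOf_gen_self (𝔭 : Primes 𝔉.PhiAcirc) : ordOf 𝔖.factor 𝔭 (𝔖.gen 𝔭) = Multiplicative.ofAdd (1 : ℚ) := by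
  simp [ordOf, 𝔖.factor_gen]

/-- The order of the prime log-divisor `gen 𝔭` away from `𝔭` is `0`. [cite: MochizukiEtTh2009, Prop 5.3 p.325 (PDF p.99)] -/
theorem ordOf_gen_of_ne {𝔭 𝔮 : Primes 𝔉.PhiAcirc} (h : 𝔭 ≠ 𝔮) : ordOf 𝔖.factor 𝔮 (𝔖.gen 𝔭) = 1 := by
  simp [ordOf, 𝔖.factor_gen, h]

/-- Linear equivalence is reflexive. [cite: MochizukiEtTh2009, Prop 5.3 proof p.326 (PDF p.100)] -/
theorem linEquiv_refl (x : Algebra.GrothendieckGroup 𝔉.PhiAcirc) : 𝔖.LinEquiv x x := by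
  simp [LinEquiv, LinEquivOf, one_mem]

/-- Linear equivalence is symmetric. [cite: MochizukiEtTh2009, Prop 5.3 proof p.326 (PDF p.100)] -/
theorem linEquiv_symm {x y : Algebra.GrothendieckGroup 𝔉.PhiAcirc} (h : 𝔖.LinEquiv x y) : 𝔖.LinEquiv y x := by
  have := inv_mem h
  simpa [LinEquiv, LinEquivOf, mul_inv_rev] using this

/-- Linear equivalence is transitive. [cite: MochizukiEtTh2009, Prop 5.3 proof p.326 (PDF p.100)] -/
theorem linEquiv_trans {x y z : Algebra.GrothendieckGroup 𝔉.PhiAcirc} (h : 𝔖.LinEquiv x y)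
    (h' : 𝔖.LinEquiv y z) : 𝔖.LinEquiv x z := by
  have := mul_mem h h'
  simpa [LinEquiv, LinEquivOf, mul_assoc] using this

end DivisorSupportData

/-! ### The two verbatim criteria of the printed proof (F4-verbatim), as predicates on the data -/

variable {𝔓 : DivisorPrimeData 𝔉}

/-- **The p.326 description of the surjection of (iv)**: "the natural surjection of (iv) is obtained by mapping
the prime determined by `a` to the prime determined by `n`" — whenever `a ∈ 𝔞` is primary cuspidal and, for some
cuspidal `b` coprime to `a`, `b − a` is cuspidally minimal and linearly equivalent to a primary non-cuspidal
`n ∈ 𝔫`, one has `cspToNcsp(𝔞) = 𝔫` (p.326 (PDF p.100)).  A predicate on the data (to be PROVED for the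
genuine special fibre from its intersection theory).  [cite: MochizukiEtTh2009, Prop 5.3 proof p.326 (PDF p.100)] -/
def CspToNcspCriterion (𝔖 : DivisorSupportData 𝔓) : Prop :=
  ∀ (𝔞 𝔫 : Primes 𝔉.PhiAcirc) (h𝔞 : 𝔓.IsCuspidal 𝔞) (h𝔫 : ¬ 𝔓.IsCuspidal 𝔫) (a b n : 𝔉.PhiAcirc),
    a ∈ 𝔞.carrier → n ∈ 𝔫.carrier →
    IsCuspidalGpOf 𝔓 𝔖.factor (Algebra.GrothendieckGroup.of b) →
    CoprimeOf 𝔖.factor (Algebra.GrothendieckGroup.of a) (Algebra.GrothendieckGroup.of b) →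
    𝔖.IsCuspidallyMinimal (Algebra.GrothendieckGroup.of b * (Algebra.GrothendieckGroup.of a)⁻¹) →
    𝔖.LinEquiv (Algebra.GrothendieckGroup.of b * (Algebra.GrothendieckGroup.of a)⁻¹)
      (Algebra.GrothendieckGroup.of n) →
    𝔓.cspToNcsp ⟨𝔞, h𝔞⟩ = ⟨𝔫, h𝔫⟩

/-- The situation of (iv) occurs at every cusp: "the preservation of (iv) follows by considering the support of
primary cuspidal elements `a ∈ Φ(A_⊚)` such that, for some `b ∈ Φ(A_⊚)^csp` which is coprime to `a` …, `b − a` is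
cuspidally minimal and linearly equivalent to a primary non-cuspidal element `n ∈ Φ(A_⊚)`" (p.326 (PDF p.100)) —
every cuspidal prime carries such `a, b, n`.  A predicate on the data.
[cite: MochizukiEtTh2009, Prop 5.3 proof p.326 (PDF p.100)] -/
def CspToNcspWitnessed (𝔖 : DivisorSupportData 𝔓) : Prop :=
  ∀ (𝔞 : Primes 𝔉.PhiAcirc), 𝔓.IsCuspidal 𝔞 → ∃ (𝔫 : Primes 𝔉.PhiAcirc) (_ : ¬ 𝔓.IsCuspidal 𝔫)
    (a b n : 𝔉.PhiAcirc), a ∈ 𝔞.carrier ∧ n ∈ 𝔫.carrier ∧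
      IsCuspidalGpOf 𝔓 𝔖.factor (Algebra.GrothendieckGroup.of b) ∧
      CoprimeOf 𝔖.factor (Algebra.GrothendieckGroup.of a) (Algebra.GrothendieckGroup.of b) ∧
      𝔖.IsCuspidallyMinimal (Algebra.GrothendieckGroup.of b * (Algebra.GrothendieckGroup.of a)⁻¹) ∧
      𝔖.LinEquiv (Algebra.GrothendieckGroup.of b * (Algebra.GrothendieckGroup.of a)⁻¹)
        (Algebra.GrothendieckGroup.of n)

/-- **The pp.326–327 adjacency criterion of (v)**: "if `a ∈ 𝔭`, `b ∈ 𝔮` correspond via the natural isomorphisms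
of (ii), then `𝔭, 𝔮` are adjacent (respectively, not adjacent) if and only if every cuspidally minimal
`c ∈ Φ(A_⊚)^gp` which is linearly equivalent to `a + b` has support of cardinality `4` (respectively, `5` or `6`).
[Here, the numbers '4', '5', '6' correspond to the number of non-cuspidal primes that are either contained in or
adjacent to a prime contained in the support of `a + b`.]" (pp.326–327 (PDF pp.100–101)).  A predicate on the
data (to be PROVED for the genuine special fibre).  [cite: MochizukiEtTh2009, Prop 5.3 proof p.326–327 (PDF pp.100–101)] -/
def AdjacencyCriterion (𝔖 : DivisorSupportData 𝔓) : Prop :=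
  ∀ (𝔭 𝔮 : Primes 𝔉.PhiAcirc) (h𝔭 : ¬ 𝔓.IsCuspidal 𝔭) (h𝔮 : ¬ 𝔓.IsCuspidal 𝔮), 𝔭 ≠ 𝔮 →
    ∀ a : 𝔭.submonoid, (a : 𝔉.PhiAcirc) ∈ 𝔭.carrier →
    let b : 𝔉.PhiAcirc := 𝔓.ncspIso 𝔭 𝔮 h𝔭 h𝔮 a
    (Adjacent 𝔓 ⟨𝔭, h𝔭⟩ ⟨𝔮, h𝔮⟩ ↔
      ∀ c, 𝔖.IsCuspidallyMinimal c →
        𝔖.LinEquiv c (Algebra.GrothendieckGroup.of (a : 𝔉.PhiAcirc) * Algebra.GrothendieckGroup.of b) →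
          (𝔖.supp c).ncard = 4) ∧
    (¬ Adjacent 𝔓 ⟨𝔭, h𝔭⟩ ⟨𝔮, h𝔮⟩ ↔
      ∀ c, 𝔖.IsCuspidallyMinimal c →
        𝔖.LinEquiv c (Algebra.GrothendieckGroup.of (a : 𝔉.PhiAcirc) * Algebra.GrothendieckGroup.of b) →
          (𝔖.supp c).ncard = 5 ∨ (𝔖.supp c).ncard = 6)

end FrobenioidThetaDivisors

end Literature.AnabelianGeometry.EtaleTheta
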